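import Literature.Probability.FitznerVanDerHofstad2017.NbwRemainderFrameNbw
import Literature.Probability.FitznerVanDerHofstad2017.NbwChebyshevNbwPoly
import HarnessLib

/-!
# NBW remainder: the RIG table sentence (b2b-lace N68c-G (iv) = W41.1 (g) junction)

Joins the three kernel modules of the NBW-remainder chain:

* `NbwRemainderFrame` (carver-g15): `IsRemKernelConst d c X R` — "`R` is a valid constant for the
  `|c|`-fold NBW-majorised remainder of composition `c` on the set `X`", with `of_le` / `le_of_nobleF2_le`;
* `NbwRemainderFrameNbw` (num3-g7): the frame constant `nbwJ d |c| (∏ P_{cᵢ})` (resp. the `e₁` kernel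
  `(∏ P_{cᵢ})·X/(2d)` on the unit vectors) IS such a constant, at the tree's NBW polynomials `nbwPoly`;
* `NbwChebyshevNbwPoly` (enum1-g5): the table-only ("RIG") Chebyshev bound
  `nbwJ d n (∏ P_{cᵢ}) ≤ Σ_j [∏ P_{cᵢ}]_j (2d)^j I_{n,j}(0) + 2 (∏ B(cᵢ)) I_{n,0}(0)` (even `Σ cᵢ`),
  and its `e₁` analogue (odd `Σ cᵢ`).

Result: the RIG right-hand side is itself a valid remainder-kernel constant, i.e. for every `p < p_c`
`trailRem d p c x ≤ Γ̄₂(p)^{|c|} · RIG(c)` (all `x`, even compositions) and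
`trailRem d p c eᵢ ≤ Γ̄₂(p)^{|c|} · RIG_{e₁}(c)` (odd compositions), plus the printed-bootstrap-factor
form with `f₂(p) ≤ Γ₂`.  These are the sentences a certificate reader evaluates from the SRW tables
`srwI d n j 0` alone (no `J`-integral quadrature).  Kernel facts only; the NoBLE citations mark where the
printed analysis uses the corresponding display, nothing is quoted as a hypothesis.
-/


noncomputable section

namespace Literature.Probability.FitznerVanDerHofstad2017

open MeasureTheory Real Finset
open scoped BigOperators
open Literature.Probability.LatticeModels
open Literature.Probability.Percolation
open Literature.Barriers.CriticalPhenomena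

variable {d : ℕ}

/-- **RIG remainder constant, x-uniform kernel (even compositions).** For `n = |c|`, `2n+1 ≤ d`,
`d ≥ 2`, `Σ cᵢ` even: the table value
`Σ_{j ≤ deg} [∏ P_{cᵢ}]_j (2d)^j I_{n,j}(0) + 2 (∏ B_{cᵢ}) I_{n,0}(0)` is a valid remainder-kernel
constant on all of `ℤ^d`. [cite: FitznerVanDerHofstad2016NoBLE, §5.3.2 (first display) p. 1097] -/
theorem isRemKernelConst_rig (c : List ℕ) (hn : 2 * c.length + 1 ≤ d) (hd : 2 ≤ d)
    (hc : Even c.sum) :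
    IsRemKernelConst d c Set.univ
      ((∑ j ∈ Finset.range (((c.map (nbwPoly d)).prod).natDegree + 1),
        ((c.map (nbwPoly d)).prod).coeff j * (2 * (d : ℝ)) ^ j * srwI d c.length j 0)
      + 2 * (c.map (nbwBulkBound d)).prod * srwI d c.length 0 0) :=
  (isRemKernelConst_nbwJ_nbwPoly c hn hd).of_le (nbwJ_nbwPoly_prod_le hn c hc)

/-- **RIG remainder constant, `e₁` kernel (odd compositions), at the unit vectors.**
[cite: FitznerVanDerHofstad2016NoBLE, §5.3.2 (first display) p. 1097; (3.34) p. 1071] -/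
theorem isRemKernelConst_rig_single (c : List ℕ) (hn : 2 * c.length + 1 ≤ d) (hd : 2 ≤ d)
    (hc : Odd c.sum) :
    IsRemKernelConst d c (Set.range fun i : Fin d => (Pi.single i (1 : ℤ) : Site d))
      ((∑ j ∈ Finset.range ((((c.map (nbwPoly d)).prod * Polynomial.C (1 / (2 * (d : ℝ))) *
          Polynomial.X)).natDegree + 1),
        (((c.map (nbwPoly d)).prod * Polynomial.C (1 / (2 * (d : ℝ))) * Polynomial.X)).coeff j *
          (2 * (d : ℝ)) ^ j * srwI d c.length j 0)
      + 2 * ((c.map (nbwBulkBound d)).prod * (Real.sqrt (2 * (d : ℝ) - 1) / d)) *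
          srwI d c.length 0 0) :=
  (isRemKernelConst_nbwJ_single_nbwPoly c hn hd).of_le
    (nbwJ_nbwPoly_prod_e1_le hn c hc)

/-- The x-uniform RIG sentence unfolded: `trailRem d p c x ≤ Γ̄₂(p)ⁿ · RIG(c)` for every
`p < p_c` and every `x`. [cite: FitznerVanDerHofstad2016NoBLE, §5.3.2 (first display) p. 1097] -/
theorem trailRem_le_nobleSup2_pow_mul_rig (c : List ℕ) (hn : 2 * c.length + 1 ≤ d) (hd : 2 ≤ d)
    (hc : Even c.sum) (p : unitInterval) (hp : p < criticalProbI d) (x : Site d) :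
    trailRem d p c x ≤ nobleSup2 d p ^ c.length *
      ((∑ j ∈ Finset.range (((c.map (nbwPoly d)).prod).natDegree + 1),
        ((c.map (nbwPoly d)).prod).coeff j * (2 * (d : ℝ)) ^ j * srwI d c.length j 0)
      + 2 * (c.map (nbwBulkBound d)).prod * srwI d c.length 0 0) :=
  isRemKernelConst_rig c hn hd hc p hp x (Set.mem_univ x)

/-- The `e₁`-kernel RIG sentence unfolded, at `x = eᵢ`.
[cite: FitznerVanDerHofstad2016NoBLE, §5.3.2 (first display) p. 1097; (3.34) p. 1071] -/
theorem trailRem_single_le_nobleSup2_pow_mul_rig (c : List ℕ) (hn : 2 * c.length + 1 ≤ d)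
    (hd : 2 ≤ d) (hc : Odd c.sum) (p : unitInterval) (hp : p < criticalProbI d) (i : Fin d) :
    trailRem d p c (Pi.single i 1) ≤ nobleSup2 d p ^ c.length *
      ((∑ j ∈ Finset.range ((((c.map (nbwPoly d)).prod * Polynomial.C (1 / (2 * (d : ℝ))) *
          Polynomial.X)).natDegree + 1),
        (((c.map (nbwPoly d)).prod * Polynomial.C (1 / (2 * (d : ℝ))) * Polynomial.X)).coeff j *
          (2 * (d : ℝ)) ^ j * srwI d c.length j 0)
      + 2 * ((c.map (nbwBulkBound d)).prod * (Real.sqrt (2 * (d : ℝ) - 1) / d)) *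
          srwI d c.length 0 0) :=
  isRemKernelConst_rig_single c hn hd hc p hp (Pi.single i 1) ⟨i, rfl⟩

/-- With the printed bootstrap factor: `f₂(p) ≤ Γ₂` gives
`trailRem d p c x ≤ ((2d-2)/(2d-1)·Γ₂)ⁿ · RIG(c)` (even compositions, RIG ≥ 0 supplied).
[cite: FitznerVanDerHofstad2016NoBLE, §5.3.2 (first display) p. 1097] -/
theorem trailRem_le_gamma_pow_mul_rig (c : List ℕ) (hn : 2 * c.length + 1 ≤ d) (hd : 2 ≤ d)
    (hc : Even c.sum) (p : unitInterval) (hp : p < criticalProbI d) {Γ₂ : ℝ}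
    (hΓ : nobleF2 d p ≤ Γ₂)
    (hR : 0 ≤ (∑ j ∈ Finset.range (((c.map (nbwPoly d)).prod).natDegree + 1),
        ((c.map (nbwPoly d)).prod).coeff j * (2 * (d : ℝ)) ^ j * srwI d c.length j 0)
      + 2 * (c.map (nbwBulkBound d)).prod * srwI d c.length 0 0) (x : Site d) :
    trailRem d p c x ≤ ((2 * d - 2) / (2 * d - 1) * Γ₂) ^ c.length *
      ((∑ j ∈ Finset.range (((c.map (nbwPoly d)).prod).natDegree + 1),
        ((c.map (nbwPoly d)).prod).coeff j * (2 * (d : ℝ)) ^ j * srwI d c.length j 0)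
      + 2 * (c.map (nbwBulkBound d)).prod * srwI d c.length 0 0) :=
  (isRemKernelConst_rig c hn hd hc).le_of_nobleF2_le hR hd p hp hΓ (Set.mem_univ x)

end Literature.Probability.FitznerVanDerHofstad2017

end
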